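import Summits.ABC.ABC.Theorems.SoloBlindCycloRad
import HarnessLib

/-!
# The unconditional floor in cyclotomic–radical coordinates, and the four-term form of abc

Solo seat `solo-ABC-blind`.  Companion to `SoloBlindCycloRad`: there, `ABC ↔ CycloRad n`, i.e. abc is
the lower bound `rad(u v (vⁿ − uⁿ)) ≥ κ_ε v^{n−ε}` for coprime `0 < u < v`, and ANY exponent above
`n − 1` already gives a polynomial abc inequality.  This file records, in the same coordinates,

* the FLOOR that is actually known: from the Stewart–Yu theorem (named fact
  `Literature.NumberTheory.DiophantineGeometry.stewart_yu`, Duke Math. J. 108 (2001), Thm. 1: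
  `log c ≤ C rad(abc)^{1/3} (log rad(abc))^3`) applied to the triple `(uⁿ, vⁿ − uⁿ, vⁿ)`:
  `n · log v ≤ C · ρ^{1/3} (log ρ)^3` with `ρ = rad(u v (vⁿ − uⁿ))` (`cycloRadFloor_of_stewartYu`).
  So the known lower bound for `ρ` is a power of `log v` where the polynomial threshold asks for
  `v^{(n−1)+θ}` and abc for `v^{n−ε}` — the gap every approach must close, stated on one line;
* the `n = 2` case unfolded as the FOUR-TERM form (arrangement `{0, ∞, 1, −1}` on `ℙ¹`):
  `ABC ↔ ∀ ε > 0 ∃ κ > 0 ∀ coprime 0 < u < v, κ v^{2−ε} ≤ rad(u · v · (v − u) · (v + u))`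
  (`abc_iff_fourTermRad`).

References: Stewart–Yu 2001 [StewartYu2001]; Pasten arXiv:2312.03566 §1 (state of the art);
Baker, Publ. Math. Debrecen 65 (2004) §2 [Baker2004].
-/

noncomputable section

open UniqueFactorizationMonoid

namespace Summit.ABC.ABC.Theorems

open Literature.NumberTheory.DiophantineGeometry

/-- The power triple `(uⁿ, vⁿ − uⁿ, vⁿ)` of a coprime pair `0 < u < v` is an abc triple (`n ≥ 1`). [folklore] -/
theorem isABCTriple_pow_sub_pow {u v n : ℕ} (hn : 1 ≤ n) (hu : 0 < u) (huv : u < v)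
    (hcop : Nat.Coprime u v) : IsABCTriple (u ^ n) (v ^ n - u ^ n) (v ^ n) := by
  have hlt : u ^ n < v ^ n := Nat.pow_lt_pow_left huv (by omega)
  refine ⟨by positivity, by omega, by omega, ?_⟩
  exact (Nat.coprime_sub_self_right hlt.le).mpr (Nat.Coprime.pow n n hcop)

/-- The radical of the power triple is `rad(u v (vⁿ − uⁿ))` (`n ≥ 1`, `0 < u < v`). [folklore] -/
theorem rad_pow_sub_pow {u v n : ℕ} (hn : 1 ≤ n) (hu : 0 < u) (huv : u < v) :
    rad (u ^ n) (v ^ n - u ^ n) (v ^ n) = radical (u * v * (v ^ n - u ^ n)) := by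
  have hlt : u ^ n < v ^ n := Nat.pow_lt_pow_left huv (by omega)
  rw [rad_def]
  exact radical_pow_mul_mul_pow u v (v ^ n - u ^ n) n (by omega) (by omega) (by omega) (by omega)

/-- **The Stewart–Yu floor in cyclotomic–radical coordinates.**  If `stewart_yu` holds
(`log c ≤ C rad(abc)^{1/3} (log rad(abc))^3` for all abc triples), then for every `n ≥ 1` and all
coprime `0 < u < v`:  `n · log v ≤ C · ρ^{1/3} · (log ρ)^3`, `ρ = rad(u v (vⁿ − uⁿ))`.
Compare: `PolyABC` needs `ρ ≥ κ v^{(n−1)+θ}`, abc needs `ρ ≥ κ_ε v^{n−ε}`. [cite: StewartYu2001, Theorem 1] -/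
theorem cycloRadFloor_of_stewartYu (h : stewart_yu) {n : ℕ} (hn : 1 ≤ n) :
    ∃ C : ℝ, ∀ u v : ℕ, 0 < u → u < v → Nat.Coprime u v →
      (n : ℝ) * Real.log v ≤
        C * ((radical (u * v * (v ^ n - u ^ n)) : ℕ) : ℝ) ^ (1 / 3 : ℝ) *
          Real.log ((radical (u * v * (v ^ n - u ^ n)) : ℕ) : ℝ) ^ 3 := by
  obtain ⟨C, hC⟩ := h
  refine ⟨C, fun u v hu huv hcop => ?_⟩
  have := hC _ _ _ (isABCTriple_pow_sub_pow hn hu huv hcop)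
  rw [rad_pow_sub_pow hn hu huv] at this
  have hv : (0 : ℝ) < v := by exact_mod_cast (show 0 < v by omega)
  have hlog : Real.log ((v ^ n : ℕ) : ℝ) = (n : ℝ) * Real.log v := by
    push_cast; rw [Real.log_pow]
  rw [hlog] at this
  exact this

/-- `u v (v² − u²) = u v (v − u)(v + u)` in `ℕ`. [folklore] -/
theorem mul_mul_sq_sub_sq (u v : ℕ) : u * v * (v ^ 2 - u ^ 2) = u * v * (v - u) * (v + u) := by
  rw [Nat.sq_sub_sq, mul_comm (v + u)]; ring

/-- **Four-term form of abc** (the arrangement `{0, ∞, 1, −1}`): abc is equivalent to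
`rad(u · v · (v − u) · (v + u)) ≥ κ_ε v^{2−ε}` for coprime `0 < u < v`. [folklore] -/
theorem abc_iff_fourTermRad :
    ABC ↔ ∀ ε : ℝ, 0 < ε → ∃ κ : ℝ, 0 < κ ∧ ∀ u v : ℕ, 0 < u → u < v → Nat.Coprime u v →
      κ * (v : ℝ) ^ ((2 : ℝ) - ε) ≤ ((radical (u * v * (v - u) * (v + u)) : ℕ) : ℝ) := by
  rw [abc_iff_cycloRad (n := 2) (by norm_num)]
  unfold CycloRad
  simp only [Nat.cast_ofNat, mul_mul_sq_sub_sq]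

end Summit.ABC.ABC.Theorems

end
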